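import Literature.NumberTheory.LFunctions.VanDerCorputZeta
import HarnessLib

/-!
# The two-dimensional Weyl–van der Corput differencing inequality (on the lattice `ℤ²`)

Topic `Literature/NumberTheory/LFunctions`, the two-dimensional companion of the tree's one-dimensional
`VdC.vanDerCorput_ineq` (`VanDerCorputZeta.lean`, Graham–Kolesnik Lemma 2.5).  Everything here is PROVED;
the only definition is the two-dimensional correlation sum `VdC.corr2`.

For `c : ℤ × ℤ → ℂ` supported in the box `B = (a₁, b₁] × (a₂, b₂]` (`aᵢ ≤ bᵢ`) and `H ≥ 1`:

  `H² ‖∑_{p ∈ B} c(p)‖² ≤ (b₁ - a₁ + H)(b₂ - a₂ + H) ∑_{d ∈ (-H, H)²} ‖C(d)‖`,   `C(d) = ∑_{p ∈ B} c(p + d) conj(c(p))`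

(`VdC.vanDerCorput_ineq_2d`).  This is the `A`-process of the two-dimensional van der Corput method
(Titchmarsh 1934; Krätzel, *Lattice Points*, §2.2): averaging the sum over the `H²` shifts `h ∈ [0, H)²`,
Cauchy–Schwarz over the enlarged box `M = (a₁ - H, b₁] × (a₂ - H, b₂]`, and
`∑_{p ∈ M} c(p + h) conj c(p + h') = C(h - h')`, each difference `d = h - h'` being counted at most `H²` times.

## References

* S. W. Graham, G. Kolesnik, *Van der Corput's Method of Exponential Sums*, LMS LN 126 (1991), Lemma 2.5
  (the one-dimensional inequality). [GrahamKolesnik1991]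
* E. Krätzel, *Lattice Points*, Kluwer 1988, §2.2 (two-dimensional Weyl steps). [Kratzel1988]
* E. C. Titchmarsh, *The lattice-points in a circle*, Proc. London Math. Soc. (2) 38 (1935), 96–115, §2.
  [Titchmarsh1935Lattice]
-/

noncomputable section

open Finset

namespace Literature.NumberTheory.LFunctions
namespace VdC

/-- The two-dimensional correlation sum `C(d) = ∑_{p ∈ (a₁,b₁]×(a₂,b₂]} c(p + d) conj(c(p))`. [folklore] -/
def corr2 (c : ℤ × ℤ → ℂ) (a₁ b₁ a₂ b₂ : ℤ) (d : ℤ × ℤ) : ℂ :=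
  ∑ p ∈ Finset.Ioc a₁ b₁ ×ˢ Finset.Ioc a₂ b₂, c (p + d) * (starRingEnd ℂ) (c p)

/-! ### Bookkeeping lemmas -/

/-- Shifting both summation variables over a product of integer intervals. [folklore] -/
theorem sum_box_shift (f : ℤ × ℤ → ℂ) (a₁ b₁ a₂ b₂ t₁ t₂ : ℤ) :
    ∑ p ∈ Finset.Ioc a₁ b₁ ×ˢ Finset.Ioc a₂ b₂, f (p + (t₁, t₂))
      = ∑ p ∈ Finset.Ioc (a₁ + t₁) (b₁ + t₁) ×ˢ Finset.Ioc (a₂ + t₂) (b₂ + t₂), f p := by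
  rw [Finset.sum_product, Finset.sum_product]
  have h1 : ∀ x : ℤ, ∑ y ∈ Finset.Ioc a₂ b₂, f ((x, y) + (t₁, t₂)) = ∑ y ∈ Finset.Ioc (a₂ + t₂) (b₂ + t₂), f (x + t₁, y) := by
    intro x
    have := sum_Ioc_shift (fun y => f (x + t₁, y)) a₂ b₂ t₂
    simpa using this
  simp_rw [h1]
  exact sum_Ioc_shift (fun x => ∑ y ∈ Finset.Ioc (a₂ + t₂) (b₂ + t₂), f (x, y)) a₁ b₁ t₁

/-- Cauchy–Schwarz: `‖∑_{m ∈ M} w m‖² ≤ #M ∑ ‖w m‖²` (any index type). [folklore] -/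
theorem norm_sq_sum_le_card_mul' {ι : Type*} (M : Finset ι) (w : ι → ℂ) :
    ‖∑ m ∈ M, w m‖ ^ 2 ≤ M.card * ∑ m ∈ M, ‖w m‖ ^ 2 := by
  calc ‖∑ m ∈ M, w m‖ ^ 2 ≤ (∑ m ∈ M, ‖w m‖) ^ 2 := by
        gcongr
        exact norm_sum_le _ _
    _ ≤ M.card * ∑ m ∈ M, ‖w m‖ ^ 2 := sq_sum_le_card_mul_sum_sq

/-- `‖w‖² = w conj(w)` inside a sum, as complex numbers. [folklore] -/
theorem ofReal_sum_norm_sq {ι : Type*} (M : Finset ι) (w : ι → ℂ) :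
    ((∑ m ∈ M, ‖w m‖ ^ 2 : ℝ) : ℂ) = ∑ m ∈ M, w m * (starRingEnd ℂ) (w m) := by
  push_cast
  refine Finset.sum_congr rfl fun m _ => ?_
  rw [Complex.mul_conj, Complex.normSq_eq_norm_sq]
  push_cast
  rfl

/-- A sum of a translate of a function supported in the box `(a₁, b₁] × (a₂, b₂]`, over any box containing
the translated support, equals the full sum. [folklore] -/
theorem sum_translate_eq {F : ℤ × ℤ → ℂ} {a₁ b₁ a₂ b₂ : ℤ}
    (hF : ∀ q, q ∉ Finset.Ioc a₁ b₁ ×ˢ Finset.Ioc a₂ b₂ → F q = 0)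
    {A₁ B₁ A₂ B₂ : ℤ} {h : ℤ × ℤ}
    (h₁ : A₁ ≤ a₁ - h.1) (h₁' : b₁ - h.1 ≤ B₁) (h₂ : A₂ ≤ a₂ - h.2) (h₂' : b₂ - h.2 ≤ B₂) :
    ∑ p ∈ Finset.Ioc A₁ B₁ ×ˢ Finset.Ioc A₂ B₂, F (p + h) = ∑ q ∈ Finset.Ioc a₁ b₁ ×ˢ Finset.Ioc a₂ b₂, F q := by
  have hsub : Finset.Ioc (a₁ - h.1) (b₁ - h.1) ×ˢ Finset.Ioc (a₂ - h.2) (b₂ - h.2)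
      ⊆ Finset.Ioc A₁ B₁ ×ˢ Finset.Ioc A₂ B₂ :=
    Finset.product_subset_product (Finset.Ioc_subset_Ioc h₁ h₁') (Finset.Ioc_subset_Ioc h₂ h₂')
  rw [← Finset.sum_subset hsub]
  · have := sum_box_shift F (a₁ - h.1) (b₁ - h.1) (a₂ - h.2) (b₂ - h.2) h.1 h.2
    simp only [sub_add_cancel] at this
    rw [← this]
  · intro p _ hp
    apply hF
    intro hmem
    apply hp
    simp only [Finset.mem_product, Finset.mem_Ioc, Prod.fst_add, Prod.snd_add] at hmem ⊢
    omega

/-- **The two-dimensional Weyl–van der Corput inequality.**  For `c` supported in `(a₁, b₁] × (a₂, b₂]`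
(`aᵢ ≤ bᵢ`) and `1 ≤ H`:
`H² ‖∑ c(p)‖² ≤ (b₁ - a₁ + H)(b₂ - a₂ + H) ∑_{d ∈ (-H,H)²} ‖C(d)‖`, `C(d) = ∑ c(p + d) conj(c(p))`.
[cite: GrahamKolesnik1991, Lemma 2.5 (Weyl–van der Corput)] -/
theorem vanDerCorput_ineq_2d {c : ℤ × ℤ → ℂ} {a₁ b₁ a₂ b₂ : ℤ}
    (hc : ∀ p, p ∉ Finset.Ioc a₁ b₁ ×ˢ Finset.Ioc a₂ b₂ → c p = 0)
    (ha₁ : a₁ ≤ b₁) (ha₂ : a₂ ≤ b₂) {H : ℕ} (hH : 1 ≤ H) :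
    (H : ℝ) ^ 2 * ‖∑ p ∈ Finset.Ioc a₁ b₁ ×ˢ Finset.Ioc a₂ b₂, c p‖ ^ 2
      ≤ ((b₁ : ℝ) - a₁ + H) * ((b₂ : ℝ) - a₂ + H) *
          ∑ d ∈ Finset.Ioo (-(H : ℤ)) H ×ˢ Finset.Ioo (-(H : ℤ)) H, ‖corr2 c a₁ b₁ a₂ b₂ d‖ := by
  set B : Finset (ℤ × ℤ) := Finset.Ioc a₁ b₁ ×ˢ Finset.Ioc a₂ b₂ with hB
  set S : ℂ := ∑ p ∈ B, c p with hS
  set M : Finset (ℤ × ℤ) := Finset.Ioc (a₁ - H) b₁ ×ˢ Finset.Ioc (a₂ - H) b₂ with hM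
  set Sh : Finset (ℤ × ℤ) := Finset.Ico (0 : ℤ) H ×ˢ Finset.Ico (0 : ℤ) H with hSh
  set D : Finset (ℤ × ℤ) := Finset.Ioo (-(H : ℤ)) H ×ˢ Finset.Ioo (-(H : ℤ)) H with hD
  have hH0 : (0 : ℝ) < H := by exact_mod_cast hH
  -- cardinalities
  have hcardM : (M.card : ℝ) = ((b₁ : ℝ) - a₁ + H) * ((b₂ : ℝ) - a₂ + H) := by
    rw [hM, Finset.card_product, Int.card_Ioc, Int.card_Ioc]
    have e1 : (((b₁ - (a₁ - H)).toNat : ℕ) : ℤ) = b₁ - (a₁ - H) := Int.toNat_of_nonneg (by omega)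
    have e2 : (((b₂ - (a₂ - H)).toNat : ℕ) : ℤ) = b₂ - (a₂ - H) := Int.toNat_of_nonneg (by omega)
    have e1' : (((b₁ - (a₁ - H)).toNat : ℕ) : ℝ) = ((b₁ - (a₁ - H) : ℤ) : ℝ) := by exact_mod_cast e1
    have e2' : (((b₂ - (a₂ - H)).toNat : ℕ) : ℝ) = ((b₂ - (a₂ - H) : ℤ) : ℝ) := by exact_mod_cast e2
    push_cast [e1', e2']
    ring
  have hcardSh : Sh.card = H ^ 2 := by
    rw [hSh, Finset.card_product, Int.card_Ico]
    simp; ring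
  -- Step 1: `∑_{p ∈ M} c(p + h) = S` for every shift `h ∈ Sh`
  have hstep1 : ∀ h ∈ Sh, ∑ p ∈ M, c (p + h) = S := by
    intro h hh
    simp only [hSh, Finset.mem_product, Finset.mem_Ico] at hh
    exact sum_translate_eq hc (by omega) (by omega) (by omega) (by omega)
  -- Step 2: `H² S = ∑_{p ∈ M} ∑_{h ∈ Sh} c(p + h)`
  have hstep2 : ((H : ℂ) ^ 2) * S = ∑ p ∈ M, ∑ h ∈ Sh, c (p + h) := by
    rw [Finset.sum_comm, Finset.sum_congr rfl hstep1, Finset.sum_const, nsmul_eq_mul, hcardSh]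
    push_cast
    ring
  -- Step 3: Cauchy–Schwarz
  have hstep3 : ‖∑ p ∈ M, ∑ h ∈ Sh, c (p + h)‖ ^ 2 ≤ M.card * ∑ p ∈ M, ‖∑ h ∈ Sh, c (p + h)‖ ^ 2 :=
    norm_sq_sum_le_card_mul' M _
  -- Step 4/5: `∑_{p ∈ M} ‖∑_h c(p+h)‖² = ∑_{h, h' ∈ Sh} C(h - h')`
  have hstep45 : ((∑ p ∈ M, ‖∑ h ∈ Sh, c (p + h)‖ ^ 2 : ℝ) : ℂ)
      = ∑ h ∈ Sh, ∑ h' ∈ Sh, corr2 c a₁ b₁ a₂ b₂ (h - h') := by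
    rw [ofReal_sum_norm_sq]
    have : ∀ p ∈ M, (∑ h ∈ Sh, c (p + h)) * (starRingEnd ℂ) (∑ h ∈ Sh, c (p + h))
        = ∑ h ∈ Sh, ∑ h' ∈ Sh, c (p + h) * (starRingEnd ℂ) (c (p + h')) := by
      intro p _
      rw [map_sum, Finset.sum_mul_sum]
    rw [Finset.sum_congr rfl this, Finset.sum_comm]
    refine Finset.sum_congr rfl fun h hh => ?_
    rw [Finset.sum_comm]
    refine Finset.sum_congr rfl fun h' hh' => ?_
    -- `∑_{p ∈ M} c(p + h) conj c(p + h') = C(h - h')`: substitute `q = p + h'`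
    simp only [hSh, Finset.mem_product, Finset.mem_Ico] at hh hh'
    rw [corr2]
    have hF : ∀ q, q ∉ Finset.Ioc a₁ b₁ ×ˢ Finset.Ioc a₂ b₂ → c (q + (h - h')) * (starRingEnd ℂ) (c q) = 0 := by
      intro q hq; rw [hc q hq, map_zero, mul_zero]
    have key := sum_translate_eq hF (A₁ := a₁ - H) (B₁ := b₁) (A₂ := a₂ - H) (B₂ := b₂) (h := h')
      (by omega) (by omega) (by omega) (by omega)
    rw [← key]
    refine Finset.sum_congr rfl fun p _ => ?_
    congr 2
    abel
  -- Step 6: each difference is counted at most `H²` times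
  have hstep6 : ‖∑ h ∈ Sh, ∑ h' ∈ Sh, corr2 c a₁ b₁ a₂ b₂ (h - h')‖
      ≤ (H : ℝ) ^ 2 * ∑ d ∈ D, ‖corr2 c a₁ b₁ a₂ b₂ d‖ := by
    have hinner : ∀ h ∈ Sh, ‖∑ h' ∈ Sh, corr2 c a₁ b₁ a₂ b₂ (h - h')‖ ≤ ∑ d ∈ D, ‖corr2 c a₁ b₁ a₂ b₂ d‖ := by
      intro h hh
      refine (norm_sum_le _ _).trans ?_
      have hinj : Set.InjOn (fun h' : ℤ × ℤ => h - h') Sh := fun x _ y _ hxy => by simpa using hxy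
      rw [← Finset.sum_image (f := fun d => ‖corr2 c a₁ b₁ a₂ b₂ d‖) hinj]
      refine Finset.sum_le_sum_of_subset_of_nonneg ?_ fun _ _ _ => norm_nonneg _
      intro d hd
      rw [Finset.mem_image] at hd
      obtain ⟨h', hh', rfl⟩ := hd
      simp only [hSh, hD, Finset.mem_product, Finset.mem_Ico, Finset.mem_Ioo, Prod.fst_sub, Prod.snd_sub] at hh hh' ⊢
      omega
    calc ‖∑ h ∈ Sh, ∑ h' ∈ Sh, corr2 c a₁ b₁ a₂ b₂ (h - h')‖
        ≤ ∑ h ∈ Sh, ‖∑ h' ∈ Sh, corr2 c a₁ b₁ a₂ b₂ (h - h')‖ := norm_sum_le _ _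
      _ ≤ ∑ h ∈ Sh, ∑ d ∈ D, ‖corr2 c a₁ b₁ a₂ b₂ d‖ := Finset.sum_le_sum hinner
      _ = (H : ℝ) ^ 2 * ∑ d ∈ D, ‖corr2 c a₁ b₁ a₂ b₂ d‖ := by
          rw [Finset.sum_const, nsmul_eq_mul, hcardSh]; push_cast; ring
  -- ### assembly
  have hreal : ∑ p ∈ M, ‖∑ h ∈ Sh, c (p + h)‖ ^ 2 ≤ (H : ℝ) ^ 2 * ∑ d ∈ D, ‖corr2 c a₁ b₁ a₂ b₂ d‖ := by
    have h1 : (∑ p ∈ M, ‖∑ h ∈ Sh, c (p + h)‖ ^ 2 : ℝ)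
        = (∑ h ∈ Sh, ∑ h' ∈ Sh, corr2 c a₁ b₁ a₂ b₂ (h - h')).re := by
      rw [← hstep45, Complex.ofReal_re]
    rw [h1]
    exact (Complex.re_le_norm _).trans hstep6
  have hH4 : ((H : ℝ) ^ 2) ^ 2 * ‖S‖ ^ 2 = ‖∑ p ∈ M, ∑ h ∈ Sh, c (p + h)‖ ^ 2 := by
    rw [← hstep2, norm_mul]
    rw [Complex.norm_pow, Complex.norm_natCast]
    ring
  have key : ((H : ℝ) ^ 2) ^ 2 * ‖S‖ ^ 2 ≤ M.card * ((H : ℝ) ^ 2 * ∑ d ∈ D, ‖corr2 c a₁ b₁ a₂ b₂ d‖) := by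
    rw [hH4]
    exact hstep3.trans (mul_le_mul_of_nonneg_left hreal (Nat.cast_nonneg _))
  rw [hcardM] at key
  have hH2 : (0 : ℝ) < (H : ℝ) ^ 2 := by positivity
  have : (H : ℝ) ^ 2 * ((H : ℝ) ^ 2 * ‖S‖ ^ 2)
      ≤ (H : ℝ) ^ 2 * (((b₁ : ℝ) - a₁ + H) * ((b₂ : ℝ) - a₂ + H) * ∑ d ∈ D, ‖corr2 c a₁ b₁ a₂ b₂ d‖) := by
    nlinarith [key]
  exact le_of_mul_le_mul_left this hH2

end VdC
end Literature.NumberTheory.LFunctions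

end
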